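/-
Copyright (c) 2026 the pub-hodgecm-mathlib formalisation cell (harness21).  Typer∕survey seat hodgecm-mathlib-typ-T5b (g0), topic T5 = P8
«(C♯)hol interior», 2026-08-31.  KERNEL module: THEOREMS ONLY (no definition, no named fact, no instance, no notation, no `sorry`).
-/
import Literature.NumberTheory.Automorphic.GLnCentralCharacter
import Literature.NumberTheory.Automorphic.UnitaryGroupAdelicCenter
import HarnessLib

/-!
# The central character of a discrete automorphic representation of a unitary group `U(J)(𝔸_F)`

Topic `NumberTheory/Automorphic`; namespace `Literature.NumberTheory.Automorphic` (dot-notation on ★ `DiscreteAutomorphicRep`).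
THEOREMS ONLY.  Cell hodgecm-mathlib FLOOR 0, programme P2, topic T5 = P8 (the interior of letter #87 (C♯)hol along [Liu2021,
Prop. 4.13 proof Case 1]): node B3 «central-character separation» of `F0/P2/T5a-TREE.md` v2 ∕ node N8–K1h of `F0/P2/T5b-TREE.md`
— Liu's «the central character `χ` of `π`» (FJcycle.tex l. 2137, Camb. J. Math. 9 (2021) p. 48) for the tree's honest `L²` object
`P : DiscreteAutomorphicRep (UnitaryGroup.adelicGroupData F E c N J) μ`.

THE MATHEMATICS ([BorelJacquet1979, §4.6]; [Mok2014, §1 Notation p. 5]: «we identify the centre of `U_{E/F}(N)` as `U_{E/F}(1)`»;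
[DeitmarEchterhoff2014, Lemma 6.1.7] Schur's lemma for unitary representations).  Let `E/F` be a quadratic extension of number
fields with non-trivial automorphism `c`, `J ∈ M_N(E)` any matrix, `U(J)(𝔸_F) = UnitaryGroup.adelic F E c N J` the adelic unitary
group of the tree and `u ↦ u · 1_N : U(1)(𝔸_F) →* U(J)(𝔸_F)` its centre (★ `UnitaryGroup.adelicCenter`, central by ★
`adelicCenter_mem_center`).  Let `P` be a discrete automorphic representation: an irreducible closed invariant subspace of
`L²(U(J)(F)\U(J)(𝔸_F), μ)` for an automorphic measure `μ` (★ `DiscreteAutomorphicRep`).  Each `R(u · 1_N)|_P` commutes with the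
irreducible unitary `P`, hence is a scalar `ψ_P(u)` (Schur, ★ `ContRepresentation.IsTopIrreducible.exists_apply_eq_smul_of_commute`);
`u ↦ ψ_P(u)` is multiplicative, of absolute value `1` (`R` is isometric, ★ `AdelicGroupData.norm_rightRegular_apply`), continuous
(strong continuity of `R`, ★ `isStronglyContinuous_rightRegular_holds`: `ψ_P(u) = ⟪f, R(u·1_N) f⟫ ∕ ⟪f, f⟫`) and trivial on the
rational centre `U(1)(F)` (a central element of `U(J)(F)` acts trivially on the quotient, ★
`AdelicGroupData.rightRegular_apply_eq_self_of_mem_center`).  This is, word for word, the tree's ★ `GLnCentralCharacter.exists_centralCharacter`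
([BorelJacquet1979, §4.6]) with `GL_n` and its scalar idèles replaced by `U(J)` and the norm-one idèles.

* (private) `continuous_adelicCenter'` — `u ↦ u · 1_N` is continuous (= ★ `UnitaryDualPair.continuous_adelicCenter` of
  `UnitaryDualPairSeesawCMLinesMajorants`, re-proved in three lines so that this spectrum-level module does not import the see-saw lane);
* **`DiscreteAutomorphicRep.exists_centralCharacter_adelicCenter`** — THE CENTRAL CHARACTER `ψ_P : U(1)(𝔸_F) →* ℂˣ` of `P`:
  unitary, continuous, `= 1` on every `u` with `u · 1_N ∈ U(J)(F)`, and `R(u · 1_N) f = ψ_P(u) • f` on `P`;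
* `DiscreteAutomorphicRep.centralCharacter_unique` — the scalar is determined by ONE non-zero vector of `P` (so any two such `ψ` agree);
* `DiscreteAutomorphicRep.eq_one_of_apply_eq_self` — if `R(u · 1_N)` fixes one non-zero vector of `P` then `ψ_P(u) = 1` for every
  central character `ψ_P` (the form of B4 «`χ_∞ = 1`»: a `u` acting trivially on one cotangent form of `P` is in the kernel).

HONEST SCOPE.  Nothing here is specific to [Liu2021]; no theta series, no archimedean statement (B4's input «the archimedean centre fixes
a holomorphic cotangent form» is NOT proved here), no identification of `U(1)(𝔸_F) = adelicOne` with the Galois-norm torus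
`relNormOneIdeles` (★ `cmAdelicOneEquivRelNormOne`, one call for the consumer).  HC_CM is proved only modulo the printed citations until
rung 0 closes; this file books nothing and discharges nothing booked (it pays an in-house node).

## References
* [BorelJacquet1979] A. Borel, H. Jacquet, *Automorphic forms and automorphic representations*, PSPM 33.1 (1979), §4.6.
* [Mok2014] C. P. Mok, *Endoscopic classification of representations of quasi-split unitary groups*, Mem. AMS 235 (2015), §1 p. 5.
* [DeitmarEchterhoff2014] A. Deitmar, S. Echterhoff, *Principles of Harmonic Analysis*, 2nd ed. (2014), Lemma 6.1.7.
* [Liu2021] Y. Liu, Camb. J. Math. 9 (2021), proof of Prop. 4.13 Case 1, l. 2137 («the central character `χ` of `π`»).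
-/

set_option autoImplicit false

noncomputable section

open scoped InnerProductSpace
open NumberField IsDedekindDomain MeasureTheory

namespace Literature.NumberTheory.Automorphic

open UnitaryGroup

variable {F E : Type} [Field F] [NumberField F] [Field E] [NumberField E] [Algebra F E]
  {c : E ≃ₐ[F] E} {N : ℕ} {J : Matrix (Fin N) (Fin N) E}
  {μ : Measure (adelicGroupData F E c N J).automorphicQuotient} [(adelicGroupData F E c N J).IsAutomorphicMeasure μ]

variable (F E c N J) in
omit [NumberField F] in
/-- `u ↦ u · 1_N : U(1)(𝔸_F) → U(J)(𝔸_F)` is continuous (`Units.map` of the continuous `Matrix.scalar`; = ★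
`UnitaryDualPair.continuous_adelicCenter`, re-proved to keep the imports at the spectrum level). [folklore] -/
private theorem continuous_adelicCenter' : Continuous (adelicCenter F E c N J) := by
  have h : Continuous fun u : ↥(adelicOne F E c) =>
      Units.map ((Matrix.scalar (Fin N) : AdeleRing (𝓞 E) E →+* Matrix (Fin N) (Fin N) (AdeleRing (𝓞 E) E)) :
          AdeleRing (𝓞 E) E →* Matrix (Fin N) (Fin N) (AdeleRing (𝓞 E) E)) (u : (AdeleRing (𝓞 E) E)ˣ) :=
    (Continuous.units_map _ ((continuous_pi fun _ => continuous_id).matrix_diagonal)).comp continuous_subtype_val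
  exact continuous_induced_rng.2 h

/-- **The central character of a discrete automorphic representation of `U(J)(𝔸_F)`** ([BorelJacquet1979, §4.6]; centre =
`U(1)` by [Mok2014, §1]).  For `P` an irreducible closed invariant subspace of `L²(U(J)(F)\U(J)(𝔸_F), μ)` there is a character
`ψ = ψ_P : U(1)(𝔸_F) →* ℂˣ` of the norm-one idèles (★ `adelicOne`) such that: `‖ψ u‖ = 1`; `u ↦ ψ u` is continuous; `ψ u = 1`
whenever the central element `u · 1_N` is a RATIONAL point (`∈` the range of ★ `UnitaryGroup.toAdelic`, in particular for `u`
principal, ★ `adelicCenter_mem_range_toAdelic`); and the centre acts on `P` through `ψ`: `R(u · 1_N) f = ψ(u) • f` for every `f ∈ P`.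
Proof: Schur (★ `IsTopIrreducible.exists_apply_eq_smul_of_commute`) for the operators `R(u · 1_N)|_P`, which commute with `P`
(★ `adelicCenter_mem_center`); unitarity from ★ `norm_rightRegular_apply`, continuity from ★ `isStronglyContinuous_rightRegular_holds`,
triviality from ★ `AdelicGroupData.rightRegular_apply_eq_self_of_mem_center`.
[cite: BorelJacquet1979, §4.6] [cite: Mok2014, §1 Notation p. 5] [cite: DeitmarEchterhoff2014, Lemma 6.1.7] -/
theorem DiscreteAutomorphicRep.exists_centralCharacter_adelicCenter
    (P : DiscreteAutomorphicRep (adelicGroupData F E c N J) μ) :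
    ∃ ψ : ↥(adelicOne F E c) →* ℂˣ,
      (∀ u, ‖((ψ u : ℂˣ) : ℂ)‖ = 1) ∧ Continuous (fun u => ((ψ u : ℂˣ) : ℂ)) ∧
      (∀ u, adelicCenter F E c N J u ∈ (toAdelic F E c N J).range → ψ u = 1) ∧
      ∀ (u : ↥(adelicOne F E c)) (f : P.space.toSubmodule),
        P.space.toContRep (adelicCenter F E c N J u) f = ((ψ u : ℂˣ) : ℂ) • f := by
  classical
  set W := P.space with hW
  haveI : CompleteSpace W.toSubmodule := W.isClosed.completeSpace_coe
  have hU : W.toContRep.IsUnitary :=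
    ClosedSubrep.isUnitary_toContRep ((adelicGroupData F E c N J).isUnitary_rightRegular μ) W
  set zc : ↥(adelicOne F E c) →* (adelicGroupData F E c N J).Adelic := adelicCenter F E c N J with hzc
  -- Schur: every `R(u · 1_N)` acts on `P` by a scalar `s u`
  have hex : ∀ u : ↥(adelicOne F E c), ∃ s : ℂ, ∀ f : W.toSubmodule, W.toContRep (zc u) f = s • f :=
    fun u => P.irreducible.exists_apply_eq_smul_of_commute hU fun g =>
      (show Commute g (zc u) from (adelicCenter_mul_comm F E c N J u g).symm).map W.toContRep
  choose s hs using hex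
  -- a non-zero vector of `P`
  obtain ⟨f₀, hf₀⟩ : ∃ f : W.toSubmodule, f ≠ 0 := by
    haveI := ((ContRepresentation.isTopIrreducible_iff _).mp P.irreducible).1
    exact exists_ne (0 : W.toSubmodule)
  -- `s u = 1` as soon as `R(u · 1_N) f₀ = f₀`
  have hs_one_of : ∀ {u : ↥(adelicOne F E c)}, W.toContRep (zc u) f₀ = f₀ → s u = 1 := by
    intro u hu
    have h := hs u f₀
    rw [hu] at h
    have h' : s u • f₀ = (1 : ℂ) • f₀ := by rw [one_smul]; exact h.symm
    exact smul_left_injective ℂ hf₀ h'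
  -- `|s u| = 1`
  have hs_norm : ∀ u, ‖s u‖ = 1 := fun u => by
    have h : ‖W.toContRep (zc u) f₀‖ = ‖f₀‖ := by
      rw [Submodule.coe_norm, ContRepresentation.ClosedSubrep.coe_toContRep_apply,
        AdelicGroupData.norm_rightRegular_apply, ← Submodule.coe_norm]
    rw [hs u f₀, norm_smul] at h
    exact (mul_eq_right₀ (norm_ne_zero_iff.mpr hf₀)).mp h
  have hs_ne : ∀ u, s u ≠ 0 := fun u h => by simpa [h] using hs_norm u
  -- multiplicativity
  have hs_one : s 1 = 1 := by
    refine hs_one_of ?_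
    have h1 : W.toContRep (zc 1) = 1 := by rw [map_one, map_one]
    rw [h1]
    rfl
  have hs_mul : ∀ x y, s (x * y) = s x * s y := fun x y => by
    have h1 : s (x * y) • f₀ = (s x * s y) • f₀ :=
      calc s (x * y) • f₀ = W.toContRep (zc (x * y)) f₀ := (hs _ f₀).symm
        _ = W.toContRep (zc x) (W.toContRep (zc y) f₀) := by rw [map_mul, map_mul]; rfl
        _ = W.toContRep (zc x) (s y • f₀) := by rw [hs y f₀]
        _ = s y • W.toContRep (zc x) f₀ := map_smul _ _ _
        _ = s y • (s x • f₀) := by rw [hs x f₀]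
        _ = (s x * s y) • f₀ := by rw [smul_smul, mul_comm (s y)]
    exact smul_left_injective ℂ hf₀ h1
  -- continuity, from the strong continuity of `R`
  have hs_cont : Continuous s := by
    have hzc_cont : Continuous zc := continuous_adelicCenter' F E c N J
    have hstrong := (adelicGroupData F E c N J).isStronglyContinuous_rightRegular_holds μ
      (f₀ : (adelicGroupData F E c N J).L2 μ)
    have hcont : Continuous fun u : ↥(adelicOne F E c) => W.toContRep (zc u) f₀ := by
      refine continuous_induced_rng.2 ?_
      simp only [Function.comp_def, ContRepresentation.ClosedSubrep.coe_toContRep_apply]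
      exact hstrong.comp hzc_cont
    have hff : (⟪f₀, f₀⟫_ℂ : ℂ) ≠ 0 := inner_self_ne_zero.mpr hf₀
    have heq : s = fun u => ⟪f₀, W.toContRep (zc u) f₀⟫_ℂ / ⟪f₀, f₀⟫_ℂ := by
      funext u
      have h1 : ⟪f₀, W.toContRep (zc u) f₀⟫_ℂ = s u * ⟪f₀, f₀⟫_ℂ := by
        rw [hs u f₀]
        exact inner_smul_right f₀ f₀ (s u)
      rw [h1, mul_div_assoc, div_self hff, mul_one]
    rw [heq]
    exact (continuous_const.inner hcont).div_const _
  -- triviality on the rational centre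
  have hs_rat : ∀ {u : ↥(adelicOne F E c)}, zc u ∈ (toAdelic F E c N J).range → s u = 1 := by
    intro u hu
    refine hs_one_of (Subtype.ext ?_)
    rw [ContRepresentation.ClosedSubrep.coe_toContRep_apply]
    exact (adelicGroupData F E c N J).rightRegular_apply_eq_self_of_mem_center μ (adelicCenter_mem_center F E c N J u)
      ((adelicGroupData F E c N J).arithmeticSubgroup_le_quotientSubgroup hu) _
  -- the character
  let s₀ : ↥(adelicOne F E c) →* ℂ := { toFun := s, map_one' := hs_one, map_mul' := hs_mul }
  refine ⟨s₀.toHomUnits, fun u => hs_norm u, hs_cont, fun u hu => Units.ext (hs_rat hu), fun u f => hs u f⟩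

/-- **The central character is determined by one non-zero vector**: if `R(u · 1_N) f = ψ(u) • f` and `R(u · 1_N) f = ψ'(u) • f` for ONE
`f ≠ 0` in `P` then `ψ u = ψ' u`; in particular any two central characters of `P` (as in
`exists_centralCharacter_adelicCenter`) coincide. [cite: BorelJacquet1979, §4.6] -/
theorem DiscreteAutomorphicRep.centralCharacter_unique (P : DiscreteAutomorphicRep (adelicGroupData F E c N J) μ)
    {ψ ψ' : ↥(adelicOne F E c) →* ℂˣ}
    (hψ : ∀ (u : ↥(adelicOne F E c)) (f : P.space.toSubmodule),
      P.space.toContRep (adelicCenter F E c N J u) f = ((ψ u : ℂˣ) : ℂ) • f)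
    (hψ' : ∀ (u : ↥(adelicOne F E c)) (f : P.space.toSubmodule),
      P.space.toContRep (adelicCenter F E c N J u) f = ((ψ' u : ℂˣ) : ℂ) • f) :
    ψ = ψ' := by
  obtain ⟨f₀, hf₀⟩ : ∃ f : P.space.toSubmodule, f ≠ 0 := by
    haveI := ((ContRepresentation.isTopIrreducible_iff _).mp P.irreducible).1
    exact exists_ne (0 : P.space.toSubmodule)
  ext u
  exact smul_left_injective ℂ hf₀ ((hψ u f₀).symm.trans (hψ' u f₀))

/-- **`ψ_P(u) = 1` as soon as `R(u · 1_N)` fixes ONE non-zero vector of `P`** — the shape in which node B4 of the T5 tree («`χ_∞ = 1`»: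
the archimedean centre fixes a holomorphic cotangent form contained in `P`) consumes the central character. [cite: BorelJacquet1979, §4.6] -/
theorem DiscreteAutomorphicRep.centralCharacter_eq_one_of_apply_eq_self (P : DiscreteAutomorphicRep (adelicGroupData F E c N J) μ)
    {ψ : ↥(adelicOne F E c) →* ℂˣ}
    (hψ : ∀ (u : ↥(adelicOne F E c)) (f : P.space.toSubmodule),
      P.space.toContRep (adelicCenter F E c N J u) f = ((ψ u : ℂˣ) : ℂ) • f)
    {u : ↥(adelicOne F E c)} {f : P.space.toSubmodule} (hf : f ≠ 0)
    (hfix : P.space.toContRep (adelicCenter F E c N J u) f = f) : ψ u = 1 := by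
  have h := hψ u f
  rw [hfix] at h
  have h' : ((ψ u : ℂˣ) : ℂ) • f = (1 : ℂ) • f := by rw [one_smul]; exact h.symm
  exact Units.ext (smul_left_injective ℂ hf h')

end Literature.NumberTheory.Automorphic

end
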